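import Mathlib
import Literature.NumberTheory.LFunctions.Zhang2022.Section4Statements
import Literature.NumberTheory.LFunctions.Zhang2022.Section4PerronIntegrability
import Literature.NumberTheory.LFunctions.Zhang2022.Section4Contour47Bound
import Literature.NumberTheory.LFunctions.Zhang2022.SkeletonAssembly
import HarnessLib

/-!
# Zhang (2022) §4, proof of Lemma 4.4: the left side of (4.8) against the printed majorant
# (`Section4.Line48Bound` from `Section4.Shift48`; `Section4.Ded48a` DISCHARGED; theorem-only,
# campaign D-0069 wave 2)

Topic `Literature/NumberTheory/LFunctions/Zhang2022` (Landau–Siegel audit tree; verdict-neutral).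
Y. Zhang, *Discrete mean estimates and the Landau–Siegel zero*, arXiv:2211.02515v1 (2022)
[Zhang2022LandauSiegel] — an unrefereed manuscript under adjudication; nothing here asserts or
denies its Theorems 1–2.

§4 p. 20 (tex L1103–L1115): "To prove (4.8) we move the contour of integration to the vertical
segments `w = −α + iv` with `|v| < 𝓛²⁰`, `w = −σ−1/2 + iv` with `|v| ≥ 𝓛²⁰`, and to the two
connecting horizontal segments `w = u ± i𝓛²⁰` with `−σ−1/2 ≤ u ≤ −α`. By a trivial bound for
`ω₁(w)` and (4.5) we see that the left side of (4.8) is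
`≪ P^{1−2σ}∫_{−𝓛²⁰}^{𝓛²⁰}|Σ_{D⁴<n≤P²}ν(n)ψ(n)n^{−(s*+iv)}|dv/(α+iv) + ε` with `s* = 1 + α − s̄`."
This file PROVES the estimate half of that passage as the typed implication
`line48Bound_of_shift48 : Shift48 → Line48Bound` (`Section4Statements`, p411835), with
`ε = exp{−𝓛¹⁰/24}`, for `s ∈ Ω₃`, every `ψ ∈ Ψ`, `D` large — and hence the deduction node
`ded48a_holds : Ded48a` (`Shift48 → Eq45 → Line48Bound`):

* middle segment `Re w = −α` (`mid48_pt`): Stirling uniformly in `t`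
  (`Section4Contour47Bound.norm_tildeZW_le_stirling`) gives
  `|Z̃(s+w,ψ)| ≤ 2(Dp²(t+v)²/4π²)^{1/2−σ+α} ≤ 2e·e^{2π}P^{1−2σ}` (both signs of the exponent
  `1/2−σ+α ∈ (−1/2, 2α)`: against `P²` from below, against `12DP²t₀²` from above, where
  `(12Dt₀²)^{2α} ≤ e`), and the Dirichlet polynomial IS the printed one:
  `Σν(n)ψ̄(n)n^{−(1−s−w)} = conj Σν(n)ψ(n)n^{−(s*+iv)}` (`norm_midSum_reflect`; `ν` is real for the
  real character `χ`), `|−α + iv| = |α + iv|`; the majorant is continuous, so the interval integral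
  of the pointwise bound is the printed integral (`intervalIntegral.norm_integral_le_of_norm_le`);
* tails `Re w = −σ−1/2`, `|v| ≥ 𝓛²⁰` (`tail48_pt`, `tail48_int`) and horizontal segments
  (`hor48_pt`): as for (4.7) (`Section4Contour47Bound`), with `|Σ_{D⁴<n≤P²}…| ≤ P⁴` (the real
  part of `1−s−w` is `≥ 0` on the whole (4.8) contour): `≤ C·exp{−𝓛¹⁰/24}` once `𝓛 ≥ 200`.

Typed-DAG note: as for `Ded47`, the hypothesis `Eq45` of `Ded48a` is not used in its printed
(`t₀`-window) form; the `t`-uniform Stirling estimate is what "(4.5)" supplies here.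
No new definitions, no new named facts; imports from the tree and Mathlib only.

## References

* Y. Zhang, arXiv:2211.02515v1 (2022), §4 p. 20, proof of Lemma 4.4, (4.8).
  [cite: Zhang2022LandauSiegel, §4 (4.8) (proof) p. 20]
* E. C. Titchmarsh, *The Theory of the Riemann Zeta-Function*, 2nd ed. (1986), §4.12 (4.12.3)
  (Stirling for `χ(s)`). [cite: Titchmarsh1986, §4.12 (4.12.3)]
-/

noncomputable section

open Complex Real ComplexConjugate MeasureTheory Set

namespace Literature.NumberTheory.LFunctions.Zhang2022.Section4

open Skeleton

variable {D : ℕ}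

/-! ## Elementary inputs -/

/-- `P < p < 2P` for `ψ (mod p) ∈ Ψ` (`p ∼ P`: `P < p < P(1 + 𝓛⁻⁶⁸)`), once `𝓛 ≥ 1`.
[cite: Zhang2022LandauSiegel, §2 (2.6) p. 5] -/
private theorem bigP_lt_p_lt (hL1 : 1 ≤ ell D) (x : Chr D) :
    bigP D < x.p ∧ (x.p : ℝ) < 2 * bigP D := by
  have hmem := x.mem
  rw [primeWindow, Finset.mem_filter, Finset.mem_Ioo] at hmem
  obtain ⟨⟨h1, h2⟩, -⟩ := hmem
  have hP0 : 0 ≤ bigP D := (Real.exp_pos _).le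
  refine ⟨(Nat.floor_lt hP0).mp h1, lt_of_lt_of_le (Nat.lt_ceil.mp h2) ?_⟩
  have hinv : (ell D ^ 68)⁻¹ ≤ 1 := inv_le_one_of_one_le₀ (one_le_pow₀ hL1)
  nlinarith

/-- `|ν(n)| ≤ τ(n) ≤ n`. [cite: Zhang2022LandauSiegel, §3 (3.1)] -/
private theorem norm_nu_le_self' [NeZero D] (χ : DirichletCharacter ℂ D) (n : ℕ) : ‖nu χ n‖ ≤ n := by
  rw [nu, divisorSumChar_apply]
  calc ‖∑ d ∈ n.divisors, χ (d : ZMod D)‖ ≤ ∑ d ∈ n.divisors, ‖χ (d : ZMod D)‖ := norm_sum_le _ _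
    _ ≤ ∑ d ∈ n.divisors, (1 : ℝ) := Finset.sum_le_sum fun d _ => χ.norm_le_one _
    _ = n.divisors.card := by simp
    _ ≤ n := by exact_mod_cast Nat.card_divisors_le_self n

/-- **Gaussian tail majorant**: for `0 < Λ`, `0 ≤ B`, `V ≤ |v|`:
`(B + |v|)²e^{−v²/(4Λ)} ≤ (2B² + 24Λ)e^{−V²/(12Λ)}·e^{−v²/(12Λ)}`. [folklore] -/
private theorem sq_mul_exp_le {Λ B V v : ℝ} (hΛ : 0 < Λ) (hV : 0 ≤ V) (hv : V ≤ |v|) :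
    (B + |v|) ^ 2 * Real.exp (-v ^ 2 / (4 * Λ))
      ≤ (2 * B ^ 2 + 24 * Λ) * Real.exp (-V ^ 2 / (12 * Λ)) * Real.exp (-v ^ 2 / (12 * Λ)) := by
  have hsplit : Real.exp (-v ^ 2 / (4 * Λ))
      = Real.exp (-v ^ 2 / (12 * Λ)) * Real.exp (-v ^ 2 / (12 * Λ)) * Real.exp (-v ^ 2 / (12 * Λ)) := by
    rw [← Real.exp_add, ← Real.exp_add]; congr 1; field_simp; ring
  have hE0 : 0 < Real.exp (-v ^ 2 / (12 * Λ)) := Real.exp_pos _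
  -- `v²e^{−v²/(12Λ)} ≤ 12Λ`
  have hx : v ^ 2 / (12 * Λ) * Real.exp (-(v ^ 2 / (12 * Λ))) ≤ 1 := by
    have h := Real.add_one_le_exp (v ^ 2 / (12 * Λ))
    have h0 : 0 ≤ v ^ 2 / (12 * Λ) := by positivity
    rw [Real.exp_neg, ← div_eq_mul_inv, div_le_one (Real.exp_pos _)]
    linarith
  have hv2 : v ^ 2 * Real.exp (-v ^ 2 / (12 * Λ)) ≤ 12 * Λ := by
    have : v ^ 2 * Real.exp (-v ^ 2 / (12 * Λ)) = 12 * Λ * (v ^ 2 / (12 * Λ) * Real.exp (-(v ^ 2 / (12 * Λ)))) := by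
      rw [neg_div]; field_simp
    rw [this]; nlinarith
  -- `e^{−v²/(12Λ)} ≤ e^{−V²/(12Λ)}`
  have hvV : Real.exp (-v ^ 2 / (12 * Λ)) ≤ Real.exp (-V ^ 2 / (12 * Λ)) := by
    rw [Real.exp_le_exp, neg_div, neg_div, neg_le_neg_iff]
    have hVv : V ^ 2 ≤ v ^ 2 := by
      calc V ^ 2 ≤ |v| ^ 2 := pow_le_pow_left₀ hV hv 2
        _ = v ^ 2 := sq_abs v
    exact div_le_div_of_nonneg_right hVv (by positivity)
  have hsq : (B + |v|) ^ 2 ≤ 2 * B ^ 2 + 2 * v ^ 2 := by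
    nlinarith [sq_nonneg (B - |v|), sq_abs v]
  calc (B + |v|) ^ 2 * Real.exp (-v ^ 2 / (4 * Λ))
      ≤ (2 * B ^ 2 + 2 * v ^ 2) * Real.exp (-v ^ 2 / (4 * Λ)) :=
        mul_le_mul_of_nonneg_right hsq (Real.exp_pos _).le
    _ = (2 * B ^ 2 * Real.exp (-v ^ 2 / (12 * Λ)) + 2 * (v ^ 2 * Real.exp (-v ^ 2 / (12 * Λ))))
          * Real.exp (-v ^ 2 / (12 * Λ)) * Real.exp (-v ^ 2 / (12 * Λ)) := by rw [hsplit]; ring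
    _ ≤ (2 * B ^ 2 * 1 + 2 * (12 * Λ)) * Real.exp (-V ^ 2 / (12 * Λ)) * Real.exp (-v ^ 2 / (12 * Λ)) := by
        gcongr
        · rw [show -v ^ 2 / (12 * Λ) = -(v ^ 2 / (12 * Λ)) by ring]
          exact Real.exp_le_one_iff.mpr (by simp; positivity)
    _ = (2 * B ^ 2 + 24 * Λ) * Real.exp (-V ^ 2 / (12 * Λ)) * Real.exp (-v ^ 2 / (12 * Λ)) := by ring

/-- `∫_ℝ e^{−v²/(12Λ)} dv = √(12πΛ)`. [folklore] -/
private theorem integral_exp_neg_sq_div (Λ : ℝ) (hΛ : 0 < Λ) :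
    ∫ v : ℝ, Real.exp (-v ^ 2 / (12 * Λ)) = Real.sqrt (12 * π * Λ) := by
  have h := integral_gaussian (1 / (12 * Λ))
  have h1 : ∀ v : ℝ, -(1 / (12 * Λ)) * v ^ 2 = -v ^ 2 / (12 * Λ) := fun v => by ring
  simp_rw [h1] at h
  rw [h]; congr 1; field_simp

/-! ## Exponential bookkeeping in `𝓛` (`D = e^𝓛`, `P = e^{𝓛⁹}`, `t₀ = 𝓛⁵¹⁹`, `𝓛₁ = 𝓛⁴⁰⁵`) -/

/-- `L^k ≤ e^{kL}` for `L ≥ 0`. [folklore] -/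
private theorem pow_le_exp_mul {L : ℝ} (hL : 0 ≤ L) (k : ℕ) : L ^ k ≤ Real.exp (k * L) := by
  rw [Real.exp_nat_mul]
  exact pow_le_pow_left₀ hL (by linarith [Real.add_one_le_exp L]) k

/-- `‖(1/(2π) : ℂ)‖ ≤ 1`. [folklore] -/
private theorem norm_one_div_two_pi_le : ‖(1 / (2 * π) : ℂ)‖ ≤ 1 := by
  rw [show (1 / (2 * π) : ℂ) = ((1 / (2 * π) : ℝ) : ℂ) by push_cast; ring, Complex.norm_real,
    Real.norm_of_nonneg (by positivity), div_le_one (by positivity)]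
  linarith [Real.pi_gt_three]

/-- `‖(1/(2πi) : ℂ)‖ ≤ 1`. [folklore] -/
private theorem norm_one_div_two_pi_I_le : ‖(1 / (2 * π * I) : ℂ)‖ ≤ 1 := by
  rw [norm_div, norm_one, norm_mul, norm_mul, Complex.norm_I, mul_one, Complex.norm_real,
    Real.norm_of_nonneg Real.pi_pos.le, Complex.norm_two, div_le_one (by positivity)]
  linarith [Real.pi_gt_three]

/-! ## (4.8): the line `Re w = −σ − 1/2` against the printed majorant -/

/-- Horizontal segments and tails of (4.8): `D·P⁶·t₀'²·e^{−𝓛¹⁰/4} ≤ e^{−𝓛¹⁰/24}` (`t₀' = 𝓛⁵¹⁹`).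
[cite: Zhang2022LandauSiegel, §4 (4.8) (proof) p. 20] -/
private theorem arith_hor48 {L : ℝ} (hL : 100 ≤ L) :
    Real.exp L * Real.exp (L ^ 9) ^ 6 * (L ^ 519) ^ 2 * Real.exp (-(L ^ 10 / 4))
      ≤ Real.exp (-(1 / 24) * L ^ 10) := by
  have hL0 : 0 ≤ L := by linarith
  have h1038 : (L ^ 519) ^ 2 ≤ Real.exp ((1038 : ℕ) * L) := by
    rw [← pow_mul]; exact pow_le_exp_mul hL0 1038
  have hL8 : (100 : ℝ) ^ 8 ≤ L ^ 8 := pow_le_pow_left₀ (by norm_num) hL 8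
  calc Real.exp L * Real.exp (L ^ 9) ^ 6 * (L ^ 519) ^ 2 * Real.exp (-(L ^ 10 / 4))
      ≤ Real.exp L * Real.exp (L ^ 9) ^ 6 * Real.exp ((1038 : ℕ) * L) * Real.exp (-(L ^ 10 / 4)) := by
        gcongr
    _ = Real.exp (L + 6 * L ^ 9 + 1038 * L - L ^ 10 / 4) := by
        rw [← Real.exp_nat_mul (L ^ 9) 6, ← Real.exp_add, ← Real.exp_add, ← Real.exp_add]
        push_cast; ring_nf
    _ ≤ Real.exp (-(1 / 24) * L ^ 10) := by
        rw [Real.exp_le_exp]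
        have h9 : L ^ 9 = L * L ^ 8 := by ring
        have h10 : L ^ 10 = L * L * L ^ 8 := by ring
        nlinarith [mul_le_mul_of_nonneg_left hL8 hL0]

/-- Tails of (4.8): `D·P⁶(2B² + 24𝓛³⁰)√(𝓛³⁰)·e^{−𝓛¹⁰/12} ≤ e^{−𝓛¹⁰/24}` with `B = 2 + 9𝓛⁵¹⁹`,
for `𝓛 ≥ 200`. [cite: Zhang2022LandauSiegel, §4 (4.8) (proof) p. 20] -/
private theorem arith_tail48 {L : ℝ} (hL : 200 ≤ L) :
    Real.exp L * Real.exp (L ^ 9) ^ 6 * (2 * (2 + 9 * L ^ 519) ^ 2 + 24 * L ^ 30) *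
        Real.sqrt (L ^ 30) * Real.exp (-(L ^ 10 / 12)) ≤ Real.exp (-(1 / 24) * L ^ 10) := by
  have hL0 : 0 ≤ L := by linarith
  have hL1 : 1 ≤ L := by linarith
  have hsqrt : Real.sqrt (L ^ 30) = L ^ 15 := by
    rw [show L ^ 30 = (L ^ 15) ^ 2 by ring, Real.sqrt_sq (by positivity)]
  have hT1 : 1 ≤ L ^ 519 := one_le_pow₀ hL1
  have h30 : L ^ 30 ≤ L ^ 1038 := pow_le_pow_right₀ hL1 (by norm_num)
  have hB : 2 * (2 + 9 * L ^ 519) ^ 2 + 24 * L ^ 30 ≤ 266 * L ^ 1038 := by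
    have : (2 + 9 * L ^ 519) ^ 2 ≤ (11 * L ^ 519) ^ 2 :=
      pow_le_pow_left₀ (by positivity) (by linarith) 2
    have e : (11 * L ^ 519) ^ 2 = 121 * L ^ 1038 := by ring
    linarith
  have h1055 : (2 * (2 + 9 * L ^ 519) ^ 2 + 24 * L ^ 30) * L ^ 15 ≤ Real.exp ((1055 : ℕ) * L) := by
    have hp := pow_le_exp_mul hL0 1055
    have hL2 : (266 : ℝ) ≤ L ^ 2 := by nlinarith
    calc (2 * (2 + 9 * L ^ 519) ^ 2 + 24 * L ^ 30) * L ^ 15 ≤ 266 * L ^ 1038 * L ^ 15 :=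
          mul_le_mul_of_nonneg_right hB (by positivity)
      _ = 266 * L ^ 1053 := by ring
      _ ≤ L ^ 2 * L ^ 1053 := mul_le_mul_of_nonneg_right hL2 (by positivity)
      _ = L ^ 1055 := by ring
      _ ≤ _ := hp
  have hL8 : (200 : ℝ) ^ 8 ≤ L ^ 8 := pow_le_pow_left₀ (by norm_num) hL 8
  calc Real.exp L * Real.exp (L ^ 9) ^ 6 * (2 * (2 + 9 * L ^ 519) ^ 2 + 24 * L ^ 30) *
        Real.sqrt (L ^ 30) * Real.exp (-(L ^ 10 / 12))
      = Real.exp L * Real.exp (L ^ 9) ^ 6 * ((2 * (2 + 9 * L ^ 519) ^ 2 + 24 * L ^ 30) * L ^ 15) *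
          Real.exp (-(L ^ 10 / 12)) := by rw [hsqrt]; ring
    _ ≤ Real.exp L * Real.exp (L ^ 9) ^ 6 * Real.exp ((1055 : ℕ) * L) * Real.exp (-(L ^ 10 / 12)) :=
        mul_le_mul_of_nonneg_right (mul_le_mul_of_nonneg_left h1055 (by positivity)) (by positivity)
    _ = Real.exp (L + 6 * L ^ 9 + 1055 * L - L ^ 10 / 12) := by
        rw [← Real.exp_nat_mul (L ^ 9) 6, ← Real.exp_add, ← Real.exp_add, ← Real.exp_add]
        push_cast; ring_nf
    _ ≤ Real.exp (-(1 / 24) * L ^ 10) := by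
        rw [Real.exp_le_exp]
        have h9 : L ^ 9 = L * L ^ 8 := by ring
        have h10 : L ^ 10 = L * L * L ^ 8 := by ring
        nlinarith [mul_le_mul_of_nonneg_left hL8 hL0]

/-- Middle segment of (4.8), the `e > 0` case of the Stirling exponent:
`(12·D·t₀'²)^{2α} ≤ e` (`2α = 2π𝓛⁻⁹`, `12Dt₀'² ≤ e^{1040𝓛}`). [cite: Zhang2022LandauSiegel, §4 (4.8) (proof) p. 20] -/
private theorem arith_mid48 {L : ℝ} (hL : 100 ≤ L) :
    (12 * Real.exp L * (L ^ 519) ^ 2) ^ (2 * (π / L ^ 9)) ≤ Real.exp 1 := by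
  have hL0 : 0 ≤ L := by linarith
  have h12 : (12 : ℝ) ≤ Real.exp L := by linarith [Real.add_one_le_exp L]
  have h1038 : (L ^ 519) ^ 2 ≤ Real.exp ((1038 : ℕ) * L) := by
    rw [← pow_mul]; exact pow_le_exp_mul hL0 1038
  have hM : 12 * Real.exp L * (L ^ 519) ^ 2 ≤ Real.exp (1040 * L) := by
    calc 12 * Real.exp L * (L ^ 519) ^ 2 ≤ Real.exp L * Real.exp L * Real.exp ((1038 : ℕ) * L) := by
          gcongr
      _ = Real.exp (1040 * L) := by rw [← Real.exp_add, ← Real.exp_add]; push_cast; ring_nf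
  have hexp : 0 ≤ 2 * (π / L ^ 9) := by positivity
  calc (12 * Real.exp L * (L ^ 519) ^ 2) ^ (2 * (π / L ^ 9))
      ≤ (Real.exp (1040 * L)) ^ (2 * (π / L ^ 9)) := Real.rpow_le_rpow (by positivity) hM hexp
    _ = Real.exp (1040 * L * (2 * (π / L ^ 9))) := by rw [← Real.exp_mul]
    _ ≤ Real.exp 1 := by
        rw [Real.exp_le_exp]
        have hL8 : (100 : ℝ) ^ 8 ≤ L ^ 8 := pow_le_pow_left₀ (by norm_num) hL 8
        have hL9 : 0 < L ^ 9 := by positivity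
        rw [show 1040 * L * (2 * (π / L ^ 9)) = 2080 * π * L / L ^ 9 by field_simp; ring,
          div_le_one hL9]
        have : L ^ 9 = L * L ^ 8 := by ring
        nlinarith [Real.pi_lt_four]

/-- The parameter window of the proof of (4.7): for `𝓛 ≥ 100` and `s ∈ Ω₃`,
`0 < σ < 3/2`, `5t₀ ≤ t − 𝓛²⁰`, `t + 𝓛²⁰ ≤ 9t₀`, `t₀ ≥ 96330`, `𝓛²⁰ ≥ 1`.
[cite: Zhang2022LandauSiegel, §4 Lemma 4.4 p. 19] -/
private theorem window_facts (hL : 100 ≤ ell D) {s : ℂ} (hs : s ∈ Omega3 D) :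
    0 < s.re ∧ s.re < 3 / 2 ∧ 5 * t0 D ≤ s.im - ell D ^ 20 ∧ s.im + ell D ^ 20 ≤ 9 * t0 D ∧
      96330 ≤ t0 D ∧ 1 ≤ ell D ^ 20 := by
  have hL1 : 1 ≤ ell D := by linarith
  obtain ⟨hσ1, hσ2, ht⟩ := hs
  have hαdef : alpha D = π / ell D ^ 9 := by rw [alpha, bigP, Real.log_exp]
  have h9 : (100 : ℝ) ^ 9 ≤ ell D ^ 9 := pow_le_pow_left₀ (by norm_num) hL 9
  have hαhalf : alpha D ≤ 1 / 2 := by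
    rw [hαdef, div_le_iff₀ (by positivity)]
    nlinarith [Real.pi_lt_four]
  have hα0 : 0 < alpha D := by rw [hαdef]; positivity
  have hT : t0 D = ell D ^ 519 := rfl
  have hV : ell1 D = ell D ^ 405 := rfl
  have h3 : (100 : ℝ) ^ 3 ≤ ell D ^ 3 := pow_le_pow_left₀ (by norm_num) hL 3
  have hT3 : ell D ^ 3 ≤ ell D ^ 519 := pow_le_pow_right₀ hL1 (by norm_num)
  have h114 : (100 : ℝ) ^ 3 ≤ ell D ^ 114 := h3.trans (pow_le_pow_right₀ hL1 (by norm_num))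
  have h1 : ell D ^ 405 * ell D ^ 114 = ell D ^ 519 := by ring
  have h2 : ell D ^ 20 ≤ ell D ^ 405 := pow_le_pow_right₀ hL1 (by norm_num)
  have h405 : (1 : ℝ) ≤ ell D ^ 405 := one_le_pow₀ hL1
  have hwin : ell D ^ 405 + 3 + ell D ^ 20 ≤ ell D ^ 519 := by nlinarith
  obtain ⟨ht1, ht2⟩ := abs_lt.mp ht
  rw [hV] at ht1 ht2
  rw [hT]
  refine ⟨by linarith, by linarith, ?_, ?_, by linarith, one_le_pow₀ hL1⟩
  · nlinarith [Real.pi_gt_three]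
  · nlinarith [Real.pi_lt_four]

/-- The Gaussian factor: `e^{(u²−v²)/(4𝓛³⁰)} ≤ e·e^{−v²/(4𝓛³⁰)}` for `u² ≤ 144 ≤ 4𝓛³⁰`.
[cite: Zhang2022LandauSiegel, §4 (4.7) (proof) p. 20] -/
private theorem exp_factor_le (hL : 100 ≤ ell D) {u : ℝ} (v : ℝ) (hu : u ^ 2 ≤ 144) :
    Real.exp ((u ^ 2 - v ^ 2) / (4 * ell D ^ 30))
      ≤ Real.exp 1 * Real.exp (-v ^ 2 / (4 * ell D ^ 30)) := by
  have hL1 : 1 ≤ ell D := by linarith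
  have hΛ : 144 ≤ 4 * ell D ^ 30 := by
    have : ell D ≤ ell D ^ 30 := le_self_pow₀ hL1 (by norm_num)
    linarith
  rw [← Real.exp_add, Real.exp_le_exp, sub_div, neg_div]
  have : u ^ 2 / (4 * ell D ^ 30) ≤ 1 := by rw [div_le_one (by positivity)]; linarith
  linarith

/-- `α = π𝓛⁻⁹ ≤ 1/2` (indeed tiny) once `𝓛 ≥ 100`. [cite: Zhang2022LandauSiegel, §2 (2.10)] -/
private theorem alpha_le_half (hL : 100 ≤ ell D) : alpha D ≤ 1 / 2 := by
  have hαdef : alpha D = π / ell D ^ 9 := by rw [alpha, bigP, Real.log_exp]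
  have h9 : (100 : ℝ) ^ 9 ≤ ell D ^ 9 := pow_le_pow_left₀ (by norm_num) hL 9
  rw [hαdef, div_le_iff₀ (by positivity)]
  nlinarith [Real.pi_lt_four]

section Pieces48

variable [NeZero D] (χ : DirichletCharacter ℂ D) (x : Chr D)

omit [NeZero D] in
/-- `ν` is real for a real (quadratic) `χ`. [cite: Zhang2022LandauSiegel, §3 (3.1)] -/
private theorem conj_nu (hq : χ.IsQuadratic) (n : ℕ) : conj (nu χ n) = nu χ n := by
  rw [nu, divisorSumChar_apply, map_sum]
  refine Finset.sum_congr rfl fun d _ => ?_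
  rcases hq (d : ZMod D) with h | h | h <;> rw [h] <;> simp

omit [NeZero D] in
/-- **The middle-segment Dirichlet polynomial is the printed one**: for `w = −α + iv`,
`Σ_{D⁴<n≤P²} ν(n)ψ̄(n)n^{−(1−s−w)} = conj(Σ_{D⁴<n≤P²} ν(n)ψ(n)n^{−(s*+iv)})` with `s* = 1 + α − s̄`
(`ν` real), so the two have the same modulus. [cite: Zhang2022LandauSiegel, §4 (4.8) (proof) p. 20] -/
theorem norm_midSum_reflect (hq : χ.IsQuadratic) (s : ℂ) (v : ℝ) :
    ‖midSum χ x (1 - s - (((-alpha D : ℝ) : ℂ) + v * I))‖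
      = ‖∑ n ∈ Finset.Ioc (D ^ 4) ⌊bigP D ^ 2⌋₊,
          nu χ n * x.ψ (n : ZMod x.p) * (n : ℂ) ^ (-(sStar D s + v * I))‖ := by
  rw [← Complex.norm_conj (∑ n ∈ Finset.Ioc (D ^ 4) ⌊bigP D ^ 2⌋₊, _), map_sum, midSum]
  congr 1
  refine Finset.sum_congr rfl fun n hn => ?_
  have hn0 : 0 < n := lt_of_le_of_lt (Nat.zero_le _) (Finset.mem_Ioc.mp hn).1
  rw [map_mul, map_mul, conj_nu χ hq n, psiBarFn]
  congr 1
  -- `conj (n^{−z}) = n^{−conj z}` and the exponents agree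
  have harg : ((n : ℂ)).arg ≠ π := by
    rw [Complex.natCast_arg]; exact Real.pi_pos.ne
  have h := Complex.conj_cpow (n : ℂ) (-(1 - s - (((-alpha D : ℝ) : ℂ) + v * I))) harg
  rw [Complex.conj_natCast] at h
  have hz : conj (-(1 - s - (((-alpha D : ℝ) : ℂ) + v * I))) = -(sStar D s + v * I) := by
    simp only [sStar, map_neg, map_sub, map_add, map_one, Complex.conj_ofReal, map_mul, Complex.conj_I,
      Complex.ofReal_neg]
    ring
  rw [hz] at h
  exact h

/-- `Σ_{D⁴<n≤P²}|ν(n)| ≤ P⁴` (`|ν(n)| ≤ n ≤ P²`, at most `P²` terms).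
[cite: Zhang2022LandauSiegel, §4 (4.8) (proof) p. 20] -/
private theorem sum_norm_nu_le : ∑ n ∈ Finset.Ioc (D ^ 4) ⌊bigP D ^ 2⌋₊, ‖nu χ n‖ ≤ bigP D ^ 4 := by
  have hP : 0 ≤ bigP D ^ 2 := by positivity
  have hfl : (⌊bigP D ^ 2⌋₊ : ℝ) ≤ bigP D ^ 2 := Nat.floor_le hP
  calc ∑ n ∈ Finset.Ioc (D ^ 4) ⌊bigP D ^ 2⌋₊, ‖nu χ n‖
      ≤ ∑ n ∈ Finset.Ioc (D ^ 4) ⌊bigP D ^ 2⌋₊, (⌊bigP D ^ 2⌋₊ : ℝ) := by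
        refine Finset.sum_le_sum fun n hn => (norm_nu_le_self' χ n).trans ?_
        exact_mod_cast (Finset.mem_Ioc.mp hn).2
    _ = ((Finset.Ioc (D ^ 4) ⌊bigP D ^ 2⌋₊).card : ℝ) * ⌊bigP D ^ 2⌋₊ := by
        rw [Finset.sum_const, nsmul_eq_mul]
    _ ≤ (⌊bigP D ^ 2⌋₊ : ℝ) * ⌊bigP D ^ 2⌋₊ := by
        gcongr
        have := Nat.card_Ioc (D ^ 4) ⌊bigP D ^ 2⌋₊
        rw [this]; exact_mod_cast Nat.sub_le _ _
    _ ≤ bigP D ^ 2 * bigP D ^ 2 := mul_le_mul hfl hfl (Nat.cast_nonneg _) hP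
    _ = bigP D ^ 4 := by ring

/-- `|Σ_{D⁴<n≤P²} ν(n)ψ̄(n)n^{−(1−s−w)}| ≤ P⁴` along the (4.8) contour (`Re w ≤ −α`, so
`Re(1−s−w) ≥ 0`; `σ < 1 + α`). [cite: Zhang2022LandauSiegel, §4 (4.8) (proof) p. 20] -/
private theorem norm_midSum_shift_le {s w : ℂ} (hσ : s.re < 1 + alpha D) (hw : w.re ≤ -alpha D) :
    ‖midSum χ x (1 - s - w)‖ ≤ bigP D ^ 4 := by
  refine (norm_midSum_le_sum_norm χ x ?_).trans (sum_norm_nu_le χ)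
  simp only [Complex.sub_re, Complex.one_re]
  linarith

/-- **Middle segment of (4.8)** `w = −α + iv`, `|v| ≤ 𝓛²⁰`: pointwise
`|f₄₈(w)P^{(9/5)w}ω₁(w)/w| ≤ 2e²e^{2π}·P^{1−2σ}|Σ_{D⁴<n≤P²}ν(n)ψ(n)n^{−(s*+iv)}|/|α+iv|`
(Stirling: `|Z̃(s+w)| ≤ 2(Dp²(t+v)²/4π²)^{1/2−σ+α} ≤ 2e·e^{2π}P^{1−2σ}`, both signs of the exponent).
[cite: Zhang2022LandauSiegel, §4 (4.8) (proof) p. 20] -/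
private theorem mid48_pt (hL : 100 ≤ ell D) (hθ : (psiChi χ x).IsPrimitive) (hq : χ.IsQuadratic)
    (hPp : bigP D < x.p) (hp2 : (x.p : ℝ) < 2 * bigP D) {s : ℂ} (hs : s ∈ Omega3 D)
    {v : ℝ} (hv : |v| ≤ ell D ^ 20) :
    ‖perronIntegrand D (f48 χ x s) (((-alpha D : ℝ) : ℂ) + v * I)‖
      ≤ 2 * Real.exp 1 ^ 2 * Real.exp (2 * π) * (bigP D ^ (1 - 2 * s.re) *
        (‖∑ n ∈ Finset.Ioc (D ^ 4) ⌊bigP D ^ 2⌋₊,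
            nu χ n * x.ψ (n : ZMod x.p) * (n : ℂ) ^ (-(sStar D s + v * I))‖
          / ‖(alpha D : ℂ) + v * I‖)) := by
  obtain ⟨hσlo, hσhi, htlo, hthi, hTbig, hV1⟩ := window_facts hL hs
  have hσ1 : 1 / 2 - alpha D < s.re := hs.1
  have hσ2 : s.re < 1 + alpha D := hs.2.1
  have hL1 : 1 ≤ ell D := by linarith
  have hP1 : 1 ≤ bigP D := Real.one_le_exp (by positivity)
  have hP0 : 0 < bigP D := by linarith
  have hp0 : (0 : ℝ) < x.p := by linarith
  have hD1 : (1 : ℝ) ≤ D := by exact_mod_cast Nat.one_le_iff_ne_zero.mpr (NeZero.ne D)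
  have hDpos : (0 : ℝ) < D := by linarith
  have hDexp : (D : ℝ) = Real.exp (ell D) := by rw [ell, Real.exp_log hDpos]
  have hαdef : alpha D = π / ell D ^ 9 := by rw [alpha, bigP, Real.log_exp]
  have hα0 : 0 < alpha D := by rw [hαdef]; positivity
  have hα1 : alpha D ≤ 1 := by
    rw [hαdef, div_le_one (by positivity)]
    have : (100 : ℝ) ^ 9 ≤ ell D ^ 9 := pow_le_pow_left₀ (by norm_num) hL 9
    nlinarith [Real.pi_lt_four]
  obtain ⟨hv1, hv2⟩ := abs_le.mp hv
  have htv : 96330 ≤ s.im + v := by linarith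
  have hT8 : 8 ≤ t0 D := by linarith
  clear hTbig
  -- nonnegativity facts first
  have hnα : 0 ≤ bigP D ^ ((9 / 5 : ℝ) * (-alpha D)) := Real.rpow_nonneg hP0.le _
  have hnP : 0 ≤ bigP D ^ (1 - 2 * s.re) := Real.rpow_nonneg hP0.le _
  have hnK : 0 ≤ 2 * (Real.exp 1 * Real.exp (2 * π) * bigP D ^ (1 - 2 * s.re)) := by positivity
  rw [norm_perronIntegrand]
  -- Z̃ by Stirling, both signs of the exponent `e = 1/2 − σ + α`
  have hsw : s + (((-alpha D : ℝ) : ℂ) + v * I)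
      = ((s.re - alpha D : ℝ) : ℂ) + ((s.im + v : ℝ) : ℂ) * I := by
    apply Complex.ext
    · simp; ring
    · simp
  have hZ := norm_tildeZW_le_stirling χ x hθ (σ' := s.re - alpha D) (t' := s.im + v)
    (abs_le.mpr ⟨by linarith, by linarith⟩) htv
  clear htv
  have hq1 : 1 ≤ (s.im + v) / (2 * π) := by
    rw [le_div_iff₀ (by positivity)]; linarith [Real.pi_lt_four, hT8]
  have h3T : 3 * t0 D ≤ π * t0 D := mul_le_mul_of_nonneg_right Real.pi_gt_three.le (by linarith)
  have hq2 : (s.im + v) / (2 * π) ≤ 3 / 2 * t0 D := by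
    rw [div_le_iff₀ (by positivity)]; linarith [h3T]
  have hq0 : 0 ≤ (s.im + v) / (2 * π) := by linarith
  have hq3 : ((s.im + v) / (2 * π)) ^ 2 ≤ 3 * t0 D ^ 2 := by
    have h := pow_le_pow_left₀ hq0 hq2 2
    have : (3 / 2 * t0 D) ^ 2 = 9 / 4 * t0 D ^ 2 := by ring
    nlinarith only [h, this, sq_nonneg (t0 D)]
  have hbaseP : bigP D ^ 2 ≤ (x.p : ℝ) * ((D * x.p : ℕ) : ℝ) * ((s.im + v) / (2 * π)) ^ 2 := by
    have h1 : bigP D ≤ x.p := hPp.le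
    have h2 : bigP D ≤ ((D * x.p : ℕ) : ℝ) := by
      push_cast
      calc bigP D ≤ (x.p : ℝ) := h1
        _ = 1 * x.p := (one_mul _).symm
        _ ≤ D * x.p := mul_le_mul_of_nonneg_right hD1 hp0.le
    have h3 : 1 ≤ ((s.im + v) / (2 * π)) ^ 2 := one_le_pow₀ hq1
    calc bigP D ^ 2 = bigP D * bigP D * 1 := by ring
      _ ≤ (x.p : ℝ) * ((D * x.p : ℕ) : ℝ) * ((s.im + v) / (2 * π)) ^ 2 :=
          mul_le_mul (mul_le_mul h1 h2 hP0.le hp0.le) h3 zero_le_one (by positivity)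
  have hbaseT : (x.p : ℝ) * ((D * x.p : ℕ) : ℝ) * ((s.im + v) / (2 * π)) ^ 2
      ≤ (12 * (D : ℝ) * t0 D ^ 2) * bigP D ^ 2 := by
    have h1 : (x.p : ℝ) ≤ 2 * bigP D := hp2.le
    have h2 : ((D * x.p : ℕ) : ℝ) ≤ D * (2 * bigP D) := by
      push_cast; exact mul_le_mul_of_nonneg_left h1 (by positivity)
    have h3 : ((s.im + v) / (2 * π)) ^ 2 ≤ 3 * t0 D ^ 2 := hq3
    calc (x.p : ℝ) * ((D * x.p : ℕ) : ℝ) * ((s.im + v) / (2 * π)) ^ 2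
        ≤ (2 * bigP D) * (D * (2 * bigP D)) * (3 * t0 D ^ 2) :=
          mul_le_mul (mul_le_mul h1 h2 (by positivity) (by positivity)) h3 (by positivity) (by positivity)
      _ = (12 * (D : ℝ) * t0 D ^ 2) * bigP D ^ 2 := by ring
  -- `(P²)^e = e^{2π} P^{1−2σ}`
  have hP2e : (bigP D ^ 2) ^ (1 / 2 - (s.re - alpha D)) = Real.exp (2 * π) * bigP D ^ (1 - 2 * s.re) := by
    rw [← Real.rpow_natCast, ← Real.rpow_mul hP0.le,
      show ((2 : ℕ) : ℝ) * (1 / 2 - (s.re - alpha D)) = 2 * alpha D + (1 - 2 * s.re) by push_cast; ring,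
      Real.rpow_add hP0, bigP, ← Real.exp_mul, hαdef]
    congr 2
    · field_simp
  have hZ' : ‖tildeZW χ x (s + (((-alpha D : ℝ) : ℂ) + v * I))‖
      ≤ 2 * (Real.exp 1 * Real.exp (2 * π) * bigP D ^ (1 - 2 * s.re)) := by
    rw [hsw]
    refine hZ.trans (mul_le_mul_of_nonneg_left ?_ (by norm_num))
    rcases le_or_gt (1 / 2 - (s.re - alpha D)) 0 with he | he
    · -- `e ≤ 0`: compare the base with `P²` from below
      calc ((x.p : ℝ) * ((D * x.p : ℕ) : ℝ) * ((s.im + v) / (2 * π)) ^ 2) ^ (1 / 2 - (s.re - alpha D))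
          ≤ (bigP D ^ 2) ^ (1 / 2 - (s.re - alpha D)) :=
            Real.rpow_le_rpow_of_nonpos (by positivity) hbaseP he
        _ = Real.exp (2 * π) * bigP D ^ (1 - 2 * s.re) := hP2e
        _ ≤ Real.exp 1 * Real.exp (2 * π) * bigP D ^ (1 - 2 * s.re) := by
            have : 1 ≤ Real.exp 1 := Real.one_le_exp (by norm_num)
            have h0 : 0 ≤ Real.exp (2 * π) * bigP D ^ (1 - 2 * s.re) := by positivity
            nlinarith
    · -- `0 < e ≤ 2α`: compare the base with `12Dt₀²·P²` from above
      have hM1 : 1 ≤ 12 * (D : ℝ) * t0 D ^ 2 := by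
        have h1 : (1:ℝ) ≤ t0 D ^ 2 := one_le_pow₀ (by linarith)
        nlinarith only [hD1, h1]
      have hMe : (12 * (D : ℝ) * t0 D ^ 2) ^ (1 / 2 - (s.re - alpha D)) ≤ Real.exp 1 := by
        calc (12 * (D : ℝ) * t0 D ^ 2) ^ (1 / 2 - (s.re - alpha D))
            ≤ (12 * (D : ℝ) * t0 D ^ 2) ^ (2 * (π / ell D ^ 9)) :=
              Real.rpow_le_rpow_of_exponent_le hM1 (by rw [← hαdef]; linarith)
          _ ≤ Real.exp 1 := by
              have h := arith_mid48 hL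
              rwa [← hDexp, show (ell D ^ 519) = t0 D from rfl] at h
      calc ((x.p : ℝ) * ((D * x.p : ℕ) : ℝ) * ((s.im + v) / (2 * π)) ^ 2) ^ (1 / 2 - (s.re - alpha D))
          ≤ ((12 * (D : ℝ) * t0 D ^ 2) * bigP D ^ 2) ^ (1 / 2 - (s.re - alpha D)) :=
            Real.rpow_le_rpow (by positivity) hbaseT he.le
        _ = (12 * (D : ℝ) * t0 D ^ 2) ^ (1 / 2 - (s.re - alpha D)) *
              (bigP D ^ 2) ^ (1 / 2 - (s.re - alpha D)) :=
            Real.mul_rpow (by positivity) (by positivity)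
        _ ≤ Real.exp 1 * (Real.exp (2 * π) * bigP D ^ (1 - 2 * s.re)) := by
            rw [hP2e]
            exact mul_le_mul_of_nonneg_right hMe (by positivity)
        _ = Real.exp 1 * Real.exp (2 * π) * bigP D ^ (1 - 2 * s.re) := by ring
  -- the Dirichlet polynomial is the printed one
  have hmid := norm_midSum_reflect χ x hq s v
  have hf : ‖f48 χ x s (((-alpha D : ℝ) : ℂ) + v * I)‖
      ≤ 2 * (Real.exp 1 * Real.exp (2 * π) * bigP D ^ (1 - 2 * s.re)) *
        ‖∑ n ∈ Finset.Ioc (D ^ 4) ⌊bigP D ^ 2⌋₊,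
            nu χ n * x.ψ (n : ZMod x.p) * (n : ℂ) ^ (-(sStar D s + v * I))‖ := by
    rw [f48, norm_mul, hmid]
    exact mul_le_mul_of_nonneg_right hZ' (norm_nonneg _)
  have hPw : bigP D ^ ((9 / 5 : ℝ) * (-alpha D)) ≤ 1 :=
    Real.rpow_le_one_of_one_le_of_nonpos hP1 (by linarith)
  have hαsq : (-alpha D) ^ 2 ≤ 144 := by
    rw [neg_sq]; nlinarith only [hα0, hα1]
  have hω1 : Real.exp (((-alpha D) ^ 2 - v ^ 2) / (4 * ell D ^ 30)) ≤ Real.exp 1 := by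
    refine (exp_factor_le hL v (u := -alpha D) hαsq).trans ?_
    have : Real.exp (-v ^ 2 / (4 * ell D ^ 30)) ≤ 1 := by
      rw [Real.exp_le_one_iff, neg_div]; exact neg_nonpos.mpr (by positivity)
    calc Real.exp 1 * Real.exp (-v ^ 2 / (4 * ell D ^ 30)) ≤ Real.exp 1 * 1 :=
          mul_le_mul_of_nonneg_left this (Real.exp_pos 1).le
      _ = Real.exp 1 := mul_one _
  have hwn : ‖(((-alpha D : ℝ)) : ℂ) + (v : ℂ) * I‖ = ‖(alpha D : ℂ) + (v : ℂ) * I‖ := by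
    rw [Complex.norm_add_mul_I, Complex.norm_add_mul_I, neg_sq]
  have hwpos : 0 < ‖(alpha D : ℂ) + (v : ℂ) * I‖ := by
    have := Complex.abs_re_le_norm ((alpha D : ℂ) + (v : ℂ) * I)
    simp only [Complex.add_re, Complex.ofReal_re, Complex.mul_re, Complex.I_re, Complex.I_im,
      Complex.ofReal_im, mul_zero, mul_one, sub_zero, add_zero] at this
    rw [abs_of_pos hα0] at this
    linarith
  rw [hwn]
  set S := ‖∑ n ∈ Finset.Ioc (D ^ 4) ⌊bigP D ^ 2⌋₊,
      nu χ n * x.ψ (n : ZMod x.p) * (n : ℂ) ^ (-(sStar D s + v * I))‖ with hSdef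
  have hS0 : 0 ≤ S := norm_nonneg _
  rw [div_le_iff₀ hwpos]
  calc ‖f48 χ x s (((-alpha D : ℝ) : ℂ) + v * I)‖ * bigP D ^ ((9 / 5 : ℝ) * (-alpha D)) *
        Real.exp (((-alpha D) ^ 2 - v ^ 2) / (4 * ell D ^ 30))
      ≤ 2 * (Real.exp 1 * Real.exp (2 * π) * bigP D ^ (1 - 2 * s.re)) * S * 1 * Real.exp 1 :=
        mul_le_mul (mul_le_mul hf hPw hnα (mul_nonneg hnK hS0)) hω1 (Real.exp_pos _).le
          (mul_nonneg (mul_nonneg hnK hS0) zero_le_one)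
    _ = 2 * Real.exp 1 ^ 2 * Real.exp (2 * π) *
        (bigP D ^ (1 - 2 * s.re) * (S / ‖(alpha D : ℂ) + (v : ℂ) * I‖)) * ‖(alpha D : ℂ) + (v : ℂ) * I‖ := by
        field_simp

/-- **Horizontal segments of (4.8)** `w = u ± i𝓛²⁰`, `−σ−1/2 < u ≤ −α`: pointwise
`|f₄₈(w)P^{(9/5)w}ω₁(w)/w| ≤ 24e·DP⁶t₀²·e^{−𝓛¹⁰/4}`. [cite: Zhang2022LandauSiegel, §4 (4.8) (proof) p. 20] -/
private theorem hor48_pt (hL : 100 ≤ ell D) (hθ : (psiChi χ x).IsPrimitive)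
    (hPp : bigP D < x.p) (hp2 : (x.p : ℝ) < 2 * bigP D) {s : ℂ} (hs : s ∈ Omega3 D)
    {V : ℝ} (hVabs : |V| = ell D ^ 20) {u : ℝ} (hu : u ∈ Set.uIoc (-s.re - 1 / 2) (-alpha D)) :
    ‖perronIntegrand D (f48 χ x s) ((u : ℂ) + (V : ℂ) * I)‖
      ≤ 24 * Real.exp 1 * ((D : ℝ) * bigP D ^ 6 * t0 D ^ 2 * Real.exp (-(ell D ^ 10 / 4))) := by
  obtain ⟨hσlo, hσhi, htlo, hthi, hTbig, hV1⟩ := window_facts hL hs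
  have hσ1 : 1 / 2 - alpha D < s.re := hs.1
  have hσ2 : s.re < 1 + alpha D := hs.2.1
  have hαdef : alpha D = π / ell D ^ 9 := by rw [alpha, bigP, Real.log_exp]
  have hα0 : 0 < alpha D := by rw [hαdef]; positivity
  have hαhalf := alpha_le_half hL
  have hP1 : 1 ≤ bigP D := Real.one_le_exp (by positivity)
  have hP0 : 0 < bigP D := by linarith
  have hp0 : (0 : ℝ) < x.p := by linarith
  have hD1 : (1 : ℝ) ≤ D := by exact_mod_cast Nat.one_le_iff_ne_zero.mpr (NeZero.ne D)
  rw [Set.uIoc_of_le (by linarith)] at hu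
  obtain ⟨hu1, hu2⟩ := hu
  have hVsq : V ^ 2 = ell D ^ 40 := by rw [← sq_abs, hVabs]; ring
  have hVrange : -ell D ^ 20 ≤ V ∧ V ≤ ell D ^ 20 := abs_le.mp hVabs.le
  have htv1 : 5 * t0 D ≤ s.im + V := by linarith [hVrange.1]
  have htv2 : s.im + V ≤ 9 * t0 D := by linarith [hVrange.2]
  have htv3 : 96330 ≤ s.im + V := by linarith
  have hT8 : 8 ≤ t0 D := by linarith
  clear hTbig
  -- nonnegativity facts first
  have hnu : 0 ≤ bigP D ^ ((9 / 5 : ℝ) * u) := Real.rpow_nonneg hP0.le _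
  have hnX : 0 ≤ 2 * (12 * (D : ℝ) * bigP D ^ 2 * t0 D ^ 2) := by positivity
  have hnX' : 0 ≤ 2 * (12 * (D : ℝ) * bigP D ^ 2 * t0 D ^ 2) * bigP D ^ 4 := by positivity
  rw [norm_perronIntegrand]
  have hsw : s + ((u : ℂ) + (V : ℂ) * I) = ((s.re + u : ℝ) : ℂ) + ((s.im + V : ℝ) : ℂ) * I := by
    apply Complex.ext <;> simp
  have hZ := norm_tildeZW_le_stirling χ x hθ (σ' := s.re + u) (t' := s.im + V)
    (abs_le.mpr ⟨by linarith, by linarith⟩) htv3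
  clear htv3
  have hq1 : 1 ≤ (s.im + V) / (2 * π) := by
    rw [le_div_iff₀ (by positivity)]; linarith [Real.pi_lt_four, hT8]
  have h3T : 3 * t0 D ≤ π * t0 D := mul_le_mul_of_nonneg_right Real.pi_gt_three.le (by linarith)
  have hq2 : (s.im + V) / (2 * π) ≤ 3 / 2 * t0 D := by
    rw [div_le_iff₀ (by positivity)]; linarith [h3T]
  have hq0 : 0 ≤ (s.im + V) / (2 * π) := by linarith
  have hq3 : ((s.im + V) / (2 * π)) ^ 2 ≤ 3 * t0 D ^ 2 := by
    have h := pow_le_pow_left₀ hq0 hq2 2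
    have : (3 / 2 * t0 D) ^ 2 = 9 / 4 * t0 D ^ 2 := by ring
    nlinarith only [h, this, sq_nonneg (t0 D)]
  have hbase1 : 1 ≤ (x.p : ℝ) * ((D * x.p : ℕ) : ℝ) * ((s.im + V) / (2 * π)) ^ 2 := by
    have h1 : 1 ≤ (x.p : ℝ) := le_trans hP1 hPp.le
    have h2 : 1 ≤ ((D * x.p : ℕ) : ℝ) := by
      push_cast
      calc (1 : ℝ) = 1 * 1 := (one_mul _).symm
        _ ≤ D * x.p := mul_le_mul hD1 h1 zero_le_one (by positivity)
    have h3 : 1 ≤ ((s.im + V) / (2 * π)) ^ 2 := one_le_pow₀ hq1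
    calc (1 : ℝ) = 1 * 1 * 1 := by ring
      _ ≤ _ := mul_le_mul (mul_le_mul h1 h2 zero_le_one (by positivity)) h3 zero_le_one (by positivity)
  have hbaseT : (x.p : ℝ) * ((D * x.p : ℕ) : ℝ) * ((s.im + V) / (2 * π)) ^ 2
      ≤ 12 * (D : ℝ) * bigP D ^ 2 * t0 D ^ 2 := by
    have h1 : (x.p : ℝ) ≤ 2 * bigP D := hp2.le
    have h2 : ((D * x.p : ℕ) : ℝ) ≤ D * (2 * bigP D) := by
      push_cast; exact mul_le_mul_of_nonneg_left h1 (by positivity)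
    have h3 : ((s.im + V) / (2 * π)) ^ 2 ≤ 3 * t0 D ^ 2 := hq3
    calc (x.p : ℝ) * ((D * x.p : ℕ) : ℝ) * ((s.im + V) / (2 * π)) ^ 2
        ≤ (2 * bigP D) * (D * (2 * bigP D)) * (3 * t0 D ^ 2) :=
          mul_le_mul (mul_le_mul h1 h2 (by positivity) (by positivity)) h3 (by positivity) (by positivity)
      _ = 12 * (D : ℝ) * bigP D ^ 2 * t0 D ^ 2 := by ring
  have hZ' : ‖tildeZW χ x (s + ((u : ℂ) + (V : ℂ) * I))‖ ≤ 2 * (12 * (D : ℝ) * bigP D ^ 2 * t0 D ^ 2) := by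
    rw [hsw]
    refine hZ.trans (mul_le_mul_of_nonneg_left ?_ (by norm_num))
    calc ((x.p : ℝ) * ((D * x.p : ℕ) : ℝ) * ((s.im + V) / (2 * π)) ^ 2) ^ (1 / 2 - (s.re + u))
        ≤ ((x.p : ℝ) * ((D * x.p : ℕ) : ℝ) * ((s.im + V) / (2 * π)) ^ 2) ^ (1 : ℝ) :=
          Real.rpow_le_rpow_of_exponent_le hbase1 (by linarith)
      _ = _ := Real.rpow_one _
      _ ≤ _ := hbaseT
  have hFw := norm_midSum_shift_le χ x (w := (u : ℂ) + (V : ℂ) * I) hσ2 (by simp; linarith)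
  have hf : ‖f48 χ x s ((u : ℂ) + (V : ℂ) * I)‖ ≤ 2 * (12 * (D : ℝ) * bigP D ^ 2 * t0 D ^ 2) * bigP D ^ 4 := by
    rw [f48, norm_mul]
    exact mul_le_mul hZ' hFw (norm_nonneg _) hnX
  have hPw : bigP D ^ ((9 / 5 : ℝ) * u) ≤ 1 :=
    Real.rpow_le_one_of_one_le_of_nonpos hP1 (by linarith)
  have hid : -ell D ^ 40 / (4 * ell D ^ 30) = -(ell D ^ 10 / 4) := by
    rw [div_eq_iff (by positivity)]; ring
  have hωw : Real.exp ((u ^ 2 - V ^ 2) / (4 * ell D ^ 30)) ≤ Real.exp 1 * Real.exp (-(ell D ^ 10 / 4)) := by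
    have hprod : 0 ≤ (-u) * (u + 2) := mul_nonneg (by linarith only [hu2, hα0]) (by linarith only [hu1, hσhi])
    have hsq : u ^ 2 = -2 * u - (-u) * (u + 2) := by ring
    have hu2' : u ^ 2 ≤ 144 := by nlinarith only [hprod, hsq, hu1, hu2, hσhi, hα0]
    have h := exp_factor_le hL V hu2'
    rw [hVsq] at h ⊢
    rw [hid] at h
    exact h
  have hwn : 1 ≤ ‖(u : ℂ) + (V : ℂ) * I‖ := by
    have := Complex.abs_im_le_norm ((u : ℂ) + (V : ℂ) * I)
    simp only [Complex.add_im, Complex.ofReal_im, Complex.mul_im, Complex.ofReal_re, Complex.I_im,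
      Complex.I_re, mul_zero, mul_one, zero_add, add_zero] at this
    rw [hVabs] at this
    linarith
  calc ‖f48 χ x s ((u : ℂ) + (V : ℂ) * I)‖ * bigP D ^ ((9 / 5 : ℝ) * u) *
        Real.exp ((u ^ 2 - V ^ 2) / (4 * ell D ^ 30)) / ‖(u : ℂ) + (V : ℂ) * I‖
      ≤ ‖f48 χ x s ((u : ℂ) + (V : ℂ) * I)‖ * bigP D ^ ((9 / 5 : ℝ) * u) *
        Real.exp ((u ^ 2 - V ^ 2) / (4 * ell D ^ 30)) :=
        div_le_self (mul_nonneg (mul_nonneg (norm_nonneg _) hnu) (Real.exp_pos _).le) hwn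
    _ ≤ 2 * (12 * (D : ℝ) * bigP D ^ 2 * t0 D ^ 2) * bigP D ^ 4 * 1 *
        (Real.exp 1 * Real.exp (-(ell D ^ 10 / 4))) :=
        mul_le_mul (mul_le_mul hf hPw hnu hnX') hωw (Real.exp_pos _).le (mul_nonneg hnX' zero_le_one)
    _ = _ := by ring

/-- **Tails of (4.8)** `w = −σ−1/2 + iv`, `|v| ≥ 𝓛²⁰`: pointwise
`|f₄₈(w)P^{(9/5)w}ω₁(w)/w| ≤ G·e^{−v²/(12𝓛³⁰)}`, `G = 4e·DP⁶(2B² + 24𝓛³⁰)e^{−𝓛⁴⁰/(12𝓛³⁰)}`,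
`B = 2 + 9t₀`. [cite: Zhang2022LandauSiegel, §4 (4.8) (proof) p. 20] -/
private theorem tail48_pt (hL : 100 ≤ ell D) (hθ : (psiChi χ x).IsPrimitive)
    (hp2 : (x.p : ℝ) < 2 * bigP D) {s : ℂ} (hs : s ∈ Omega3 D)
    {v : ℝ} (hv : ell D ^ 20 ≤ |v|) :
    ‖perronIntegrand D (f48 χ x s) (((-s.re - 1 / 2 : ℝ) : ℂ) + v * I)‖
      ≤ (4 * Real.exp 1 * ((D : ℝ) * bigP D ^ 6) *
          ((2 * (2 + 9 * t0 D) ^ 2 + 24 * ell D ^ 30) * Real.exp (-(ell D ^ 20) ^ 2 / (12 * ell D ^ 30))))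
        * Real.exp (-(1 / (12 * ell D ^ 30)) * v ^ 2) := by
  obtain ⟨hσlo, hσhi, htlo, hthi, -, hV1⟩ := window_facts hL hs
  have hσ2 : s.re < 1 + alpha D := hs.2.1
  have hαdef : alpha D = π / ell D ^ 9 := by rw [alpha, bigP, Real.log_exp]
  have hα1 : alpha D ≤ 1 := by
    rw [hαdef, div_le_one (by positivity)]
    have : (100 : ℝ) ^ 9 ≤ ell D ^ 9 := pow_le_pow_left₀ (by norm_num) hL 9
    nlinarith [Real.pi_lt_four]
  have hP1 : 1 ≤ bigP D := Real.one_le_exp (by positivity)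
  have hP0 : 0 < bigP D := by linarith
  have hp0 : (0 : ℝ) < x.p := by exact_mod_cast x.prime.pos
  have hσ1 : 1 / 2 - alpha D < s.re := hs.1
  have hαhalf := alpha_le_half hL
  have ht0 : 0 < s.im := by linarith
  have hΛ : 0 < ell D ^ 30 := by positivity
  -- nonnegativity facts first
  have hna : 0 ≤ bigP D ^ ((9 / 5 : ℝ) * (-s.re - 1 / 2)) := Real.rpow_nonneg hP0.le _
  have hnD : 0 ≤ (D : ℝ) * (2 * bigP D) ^ 2 := by positivity
  have hnP4 : 0 ≤ bigP D ^ 4 := by positivity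
  have hnG : 0 ≤ 4 * Real.exp 1 * ((D : ℝ) * bigP D ^ 6) := by positivity
  rw [norm_perronIntegrand]
  have hsw_re : (s + (((-s.re - 1 / 2 : ℝ) : ℂ) + v * I)).re = -1 / 2 := by simp; ring
  have hZ := norm_tildeZW_le_of_re_neg_half χ x hθ hsw_re
  have hnorm : 1 + ‖s + (((-s.re - 1 / 2 : ℝ) : ℂ) + v * I)‖ ≤ (2 + 9 * t0 D) + |v| := by
    have h1 := Complex.norm_le_abs_re_add_abs_im (s + (((-s.re - 1 / 2 : ℝ) : ℂ) + v * I))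
    have him : (s + (((-s.re - 1 / 2 : ℝ) : ℂ) + v * I)).im = s.im + v := by simp
    rw [hsw_re, him] at h1
    have h2 : |s.im + v| ≤ s.im + |v| := by
      calc |s.im + v| ≤ |s.im| + |v| := abs_add_le _ _
        _ = s.im + |v| := by rw [abs_of_pos ht0]
    have h3 : |(-1 : ℝ) / 2| = 1 / 2 := by norm_num
    rw [h3] at h1
    linarith
  have hZ' : ‖tildeZW χ x (s + (((-s.re - 1 / 2 : ℝ) : ℂ) + v * I))‖
      ≤ (D : ℝ) * (2 * bigP D) ^ 2 * ((2 + 9 * t0 D) + |v|) ^ 2 := by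
    refine hZ.trans ?_
    have h1 : (x.p : ℝ) ^ 2 ≤ (2 * bigP D) ^ 2 := pow_le_pow_left₀ hp0.le hp2.le 2
    have h2 : (1 + ‖s + (((-s.re - 1 / 2 : ℝ) : ℂ) + v * I)‖) ^ 2 ≤ ((2 + 9 * t0 D) + |v|) ^ 2 :=
      pow_le_pow_left₀ (by positivity) hnorm 2
    exact mul_le_mul (mul_le_mul_of_nonneg_left h1 (Nat.cast_nonneg _)) h2 (sq_nonneg _) hnD
  have hFw := norm_midSum_shift_le χ x (w := ((-s.re - 1 / 2 : ℝ) : ℂ) + v * I) hσ2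
    (by simp; linarith)
  have hnZ : 0 ≤ (D : ℝ) * (2 * bigP D) ^ 2 * ((2 + 9 * t0 D) + |v|) ^ 2 := mul_nonneg hnD (sq_nonneg _)
  have hf : ‖f48 χ x s (((-s.re - 1 / 2 : ℝ) : ℂ) + v * I)‖
      ≤ (D : ℝ) * (2 * bigP D) ^ 2 * ((2 + 9 * t0 D) + |v|) ^ 2 * bigP D ^ 4 := by
    rw [f48, norm_mul]
    exact mul_le_mul hZ' hFw (norm_nonneg _) hnZ
  have hPw : bigP D ^ ((9 / 5 : ℝ) * (-s.re - 1 / 2)) ≤ 1 :=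
    Real.rpow_le_one_of_one_le_of_nonpos hP1 (by linarith only [hσlo])
  have hsq' : (-s.re - 1 / 2) ^ 2 ≤ 144 := by
    have h1 : 0 ≤ (2 - s.re) * (s.re + 10) := mul_nonneg (by linarith only [hσhi]) (by linarith only [hσlo])
    have h2 : (-s.re - 1 / 2) ^ 2 = 81 / 4 - 7 * s.re - (2 - s.re) * (s.re + 10) := by ring
    linarith only [h1, h2, hσlo]
  have hωw := exp_factor_le hL v (u := -s.re - 1 / 2) hsq'
  have hwn : 1 ≤ ‖(((-s.re - 1 / 2 : ℝ) : ℂ)) + (v : ℂ) * I‖ := by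
    have := Complex.abs_im_le_norm ((((-s.re - 1 / 2 : ℝ) : ℂ)) + (v : ℂ) * I)
    simp only [Complex.add_im, Complex.ofReal_im, Complex.mul_im, Complex.ofReal_re, Complex.I_im,
      Complex.I_re, mul_zero, mul_one, zero_add, add_zero] at this
    linarith
  have hgauss := sq_mul_exp_le (B := 2 + 9 * t0 D) hΛ (by positivity) hv
  calc ‖f48 χ x s (((-s.re - 1 / 2 : ℝ) : ℂ) + v * I)‖ * bigP D ^ ((9 / 5 : ℝ) * (-s.re - 1 / 2)) *
        Real.exp (((-s.re - 1 / 2) ^ 2 - v ^ 2) / (4 * ell D ^ 30)) /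
        ‖(((-s.re - 1 / 2 : ℝ) : ℂ)) + (v : ℂ) * I‖
      ≤ ‖f48 χ x s (((-s.re - 1 / 2 : ℝ) : ℂ) + v * I)‖ * bigP D ^ ((9 / 5 : ℝ) * (-s.re - 1 / 2)) *
        Real.exp (((-s.re - 1 / 2) ^ 2 - v ^ 2) / (4 * ell D ^ 30)) :=
        div_le_self (mul_nonneg (mul_nonneg (norm_nonneg _) hna) (Real.exp_pos _).le) hwn
    _ ≤ (D : ℝ) * (2 * bigP D) ^ 2 * ((2 + 9 * t0 D) + |v|) ^ 2 * bigP D ^ 4 * 1 *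
        (Real.exp 1 * Real.exp (-v ^ 2 / (4 * ell D ^ 30))) :=
        mul_le_mul (mul_le_mul hf hPw hna (mul_nonneg hnZ hnP4)) hωw (Real.exp_pos _).le
          (mul_nonneg (mul_nonneg hnZ hnP4) zero_le_one)
    _ = 4 * Real.exp 1 * ((D : ℝ) * bigP D ^ 6) *
        (((2 + 9 * t0 D) + |v|) ^ 2 * Real.exp (-v ^ 2 / (4 * ell D ^ 30))) := by ring
    _ ≤ 4 * Real.exp 1 * ((D : ℝ) * bigP D ^ 6) *
        ((2 * (2 + 9 * t0 D) ^ 2 + 24 * ell D ^ 30) * Real.exp (-(ell D ^ 20) ^ 2 / (12 * ell D ^ 30)) *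
          Real.exp (-v ^ 2 / (12 * ell D ^ 30))) :=
        mul_le_mul_of_nonneg_left hgauss hnG
    _ = _ := by
        rw [show -(1 / (12 * ell D ^ 30)) * v ^ 2 = -v ^ 2 / (12 * ell D ^ 30) by ring]; ring

/-- **Tails of (4.8), integrated** over a measurable `S ⊆ {|v| ≥ 𝓛²⁰}`: `≤ G√(12π𝓛³⁰)`.
[cite: Zhang2022LandauSiegel, §4 (4.8) (proof) p. 20] -/
private theorem tail48_int (hL : 100 ≤ ell D) (hθ : (psiChi χ x).IsPrimitive)
    (hp2 : (x.p : ℝ) < 2 * bigP D) {s : ℂ} (hs : s ∈ Omega3 D)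
    {S : Set ℝ} (hS : MeasurableSet S) (hSv : ∀ v ∈ S, ell D ^ 20 ≤ |v|) :
    ‖∫ v in S, perronIntegrand D (f48 χ x s) (((-s.re - 1 / 2 : ℝ) : ℂ) + v * I)‖
      ≤ (4 * Real.exp 1 * ((D : ℝ) * bigP D ^ 6) *
          ((2 * (2 + 9 * t0 D) ^ 2 + 24 * ell D ^ 30) * Real.exp (-(ell D ^ 20) ^ 2 / (12 * ell D ^ 30))))
        * Real.sqrt (12 * π * ell D ^ 30) := by
  have hL0 : 0 < ell D := by linarith
  have hb : 0 < 1 / (12 * ell D ^ 30) := by positivity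
  have hG : 0 ≤ (4 * Real.exp 1 * ((D : ℝ) * bigP D ^ 6) *
      ((2 * (2 + 9 * t0 D) ^ 2 + 24 * ell D ^ 30) * Real.exp (-(ell D ^ 20) ^ 2 / (12 * ell D ^ 30)))) := by
    positivity
  have hg_int : Integrable fun v : ℝ => (4 * Real.exp 1 * ((D : ℝ) * bigP D ^ 6) *
      ((2 * (2 + 9 * t0 D) ^ 2 + 24 * ell D ^ 30) * Real.exp (-(ell D ^ 20) ^ 2 / (12 * ell D ^ 30))))
        * Real.exp (-(1 / (12 * ell D ^ 30)) * v ^ 2) :=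
    (integrable_exp_neg_mul_sq hb).const_mul _
  calc ‖∫ v in S, perronIntegrand D (f48 χ x s) (((-s.re - 1 / 2 : ℝ) : ℂ) + v * I)‖
      ≤ ∫ v in S, (4 * Real.exp 1 * ((D : ℝ) * bigP D ^ 6) *
          ((2 * (2 + 9 * t0 D) ^ 2 + 24 * ell D ^ 30) * Real.exp (-(ell D ^ 20) ^ 2 / (12 * ell D ^ 30))))
            * Real.exp (-(1 / (12 * ell D ^ 30)) * v ^ 2) :=
        norm_integral_le_of_norm_le hg_int.integrableOn
          (ae_restrict_of_forall_mem hS fun v hv => tail48_pt χ x hL hθ hp2 hs (hSv v hv))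
    _ ≤ ∫ v : ℝ, (4 * Real.exp 1 * ((D : ℝ) * bigP D ^ 6) *
          ((2 * (2 + 9 * t0 D) ^ 2 + 24 * ell D ^ 30) * Real.exp (-(ell D ^ 20) ^ 2 / (12 * ell D ^ 30))))
            * Real.exp (-(1 / (12 * ell D ^ 30)) * v ^ 2) :=
        setIntegral_le_integral hg_int (Filter.Eventually.of_forall fun v => by positivity)
    _ = _ := by rw [integral_const_mul, integral_gaussian]; congr 2; field_simp

omit [NeZero D] in
/-- The printed majorant's integrand is continuous in `v` (a finite Dirichlet polynomial over
`|α + iv| ≥ α > 0`), hence interval-integrable. [cite: Zhang2022LandauSiegel, §4 (4.8) (proof) p. 20] -/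
private theorem continuous_majorant (hα : 0 < alpha D) (s : ℂ) :
    Continuous fun v : ℝ =>
      ‖∑ n ∈ Finset.Ioc (D ^ 4) ⌊bigP D ^ 2⌋₊,
          nu χ n * x.ψ (n : ZMod x.p) * (n : ℂ) ^ (-(sStar D s + v * I))‖
        / ‖(alpha D : ℂ) + v * I‖ := by
  refine Continuous.div ?_ ?_ fun v => ?_
  · refine Continuous.norm ?_
    refine continuous_finsetSum _ fun n hn => ?_
    have hn0 : (n : ℂ) ≠ 0 := by
      exact_mod_cast (lt_of_le_of_lt (Nat.zero_le _) (Finset.mem_Ioc.mp hn).1).ne'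
    refine Continuous.mul continuous_const ?_
    refine Continuous.const_cpow ?_ (Or.inl hn0)
    exact (continuous_const.add (Complex.continuous_ofReal.mul continuous_const)).neg
  · exact (continuous_const.add (Complex.continuous_ofReal.mul continuous_const)).norm
  · have := Complex.abs_re_le_norm ((alpha D : ℂ) + (v : ℂ) * I)
    simp only [Complex.add_re, Complex.ofReal_re, Complex.mul_re, Complex.I_re, Complex.I_im,
      Complex.ofReal_im, mul_zero, mul_one, sub_zero, add_zero] at this
    rw [abs_of_pos hα] at this
    exact (lt_of_lt_of_le hα this).ne'

end Pieces48

/-- **The left side of (4.8) against the printed majorant** (`Z22:§4.u032`–`u034`, §4 p. 20: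
"By a trivial bound for `ω₁(w)` and (4.5) we see that the left side of (4.8) is
`≪ P^{1−2σ}∫_{−𝓛²⁰}^{𝓛²⁰}|Σ_{D⁴<n≤P²}ν(n)ψ(n)n^{−(s*+iv)}|dv/(α+iv) + ε` with `s* = 1 + α − s̄`"):
from the contour shift `Shift48` (moving `Re w = −σ−1/2` to `Re w = −α` for `|v| < 𝓛²⁰`), for
`s ∈ Ω₃`, every `ψ`, `D` large: tails and horizontal segments are `≤ C·exp{−𝓛¹⁰/24}`
(`|Z̃| ≤ Dp²(1+|s+w|)²` on `Re(s+w) = −1/2`, `|Σ_{D⁴<n≤P²}…| ≤ P⁴`, `|ω₁(u ± i𝓛²⁰)| ≤ e·e^{−𝓛¹⁰/4}`),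
and on `Re w = −α` Stirling gives `|Z̃(s+w,ψ)| ≤ 2e·e^{2π}P^{1−2σ}` while
`Σν(n)ψ̄(n)n^{−(1−s−w)} = conj Σν(n)ψ(n)n^{−(s*+iv)}` — the printed integrand exactly.
[cite: Zhang2022LandauSiegel, §4 (4.8) (proof) p. 20] -/
theorem line48Bound_of_shift48 (hshift : Shift48) : Line48Bound := by
  obtain ⟨D₁, hshift⟩ := hshift
  refine ⟨1 / 24, by norm_num, 2 * Real.exp 1 ^ 2 * Real.exp (2 * π)
      + 1792 * Real.exp 1 * Real.sqrt (12 * π) + 96 * Real.exp 1,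
    max D₁ (max 3 ⌈Real.exp 200⌉₊), fun D _ χ hD hq hp x s hs => ?_⟩
  -- parameters
  have hD₁ : D₁ ≤ D := le_trans (le_max_left _ _) hD
  have hD3 : 3 ≤ D := le_trans (le_trans (le_max_left _ _) (le_max_right _ _)) hD
  have hL : 200 ≤ ell D := by
    have h : Real.exp 200 ≤ D :=
      le_trans (Nat.le_ceil _) (by exact_mod_cast le_trans (le_trans (le_max_right _ _) (le_max_right _ _)) hD)
    exact (Real.le_log_iff_exp_le (lt_of_lt_of_le (Real.exp_pos _) h)).mpr h
  have hL100 : 100 ≤ ell D := by linarith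
  have hL1 : 1 ≤ ell D := by linarith
  have hL0 : 0 < ell D := by linarith
  have hDpos : (0 : ℝ) < D := by exact_mod_cast lt_of_lt_of_le (by norm_num) hD3
  have hDexp : (D : ℝ) = Real.exp (ell D) := by rw [ell, Real.exp_log hDpos]
  have hPdef : bigP D = Real.exp (ell D ^ 9) := rfl
  have hP0 : 0 < bigP D := Real.exp_pos _
  have hαdef : alpha D = π / ell D ^ 9 := by rw [alpha, bigP, Real.log_exp]
  have hα0 : 0 < alpha D := by rw [hαdef]; positivity
  have hαhalf := alpha_le_half hL100
  obtain ⟨hPp, hp2⟩ := bigP_lt_p_lt hL1 x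
  have hθ : (psiChi χ x).IsPrimitive := psiChiPrimitive_holds D χ x hD3 hp
  obtain ⟨hσlo, hσhi, htlo, hthi, -, hV1⟩ := window_facts hL100 hs
  have hσ1 : 1 / 2 - alpha D < s.re := hs.1
  have hεdef : epsW (1 / 24) D = Real.exp (-(1 / 24) * ell D ^ 10) := rfl
  -- the printed majorant `X = P^{1−2σ}∫…` and its nonnegativity
  set X : ℝ := bigP D ^ (1 - 2 * s.re) *
    ∫ v in (-(ell D ^ 20))..(ell D ^ 20),
      ‖∑ n ∈ Finset.Ioc (D ^ 4) ⌊bigP D ^ 2⌋₊,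
          nu χ n * x.ψ (n : ZMod x.p) * (n : ℂ) ^ (-(sStar D s + v * I))‖
        / ‖(alpha D : ℂ) + v * I‖ with hXdef
  have hcont := continuous_majorant χ x hα0 s
  have hX0 : 0 ≤ X := by
    rw [hXdef]
    refine mul_nonneg (Real.rpow_nonneg hP0.le _) ?_
    exact intervalIntegral.integral_nonneg (by linarith) fun v _ => by positivity
  have hε0 : 0 ≤ epsW (1 / 24) D := (Real.exp_pos _).le
  ----------------------------------------------------------------
  -- (M) the middle segment gives the printed majorant
  ----------------------------------------------------------------
  have hMid : ‖∫ v in (-ell D ^ 20)..(ell D ^ 20), perronIntegrand D (f48 χ x s)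
      (((-alpha D : ℝ) : ℂ) + v * I)‖ ≤ 2 * Real.exp 1 ^ 2 * Real.exp (2 * π) * X := by
    have hle : -ell D ^ 20 ≤ ell D ^ 20 := by linarith
    refine (intervalIntegral.norm_integral_le_of_norm_le hle
      (Filter.Eventually.of_forall fun v hv => mid48_pt χ x hL100 hθ hq hPp hp2 hs
        (abs_le.mpr ⟨le_of_lt hv.1, hv.2⟩))
      (((hcont.const_mul (bigP D ^ (1 - 2 * s.re))).const_mul
        (2 * Real.exp 1 ^ 2 * Real.exp (2 * π))).intervalIntegrable _ _)).trans (le_of_eq ?_)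
    rw [intervalIntegral.integral_const_mul, intervalIntegral.integral_const_mul]
  ----------------------------------------------------------------
  -- (H) horizontal segments
  ----------------------------------------------------------------
  have hHor : ∀ V : ℝ, |V| = ell D ^ 20 →
      ‖∫ u in (-s.re - 1 / 2)..(-alpha D), perronIntegrand D (f48 χ x s) ((u : ℂ) + (V : ℂ) * I)‖
        ≤ 48 * Real.exp 1 * epsW (1 / 24) D := by
    intro V hV
    refine (intervalIntegral.norm_integral_le_of_norm_le_const fun u hu =>
      hor48_pt χ x hL100 hθ hPp hp2 hs hV hu).trans ?_
    have hlen : |(-alpha D) - (-s.re - 1 / 2)| ≤ 2 := by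
      rw [abs_of_nonneg (by linarith)]
      linarith
    have key : (D : ℝ) * bigP D ^ 6 * t0 D ^ 2 * Real.exp (-(ell D ^ 10 / 4)) ≤ epsW (1 / 24) D := by
      have h := arith_hor48 hL100
      rw [← hDexp, ← hPdef] at h
      rw [hεdef]; exact h
    have h0 : 0 ≤ 24 * Real.exp 1 * ((D : ℝ) * bigP D ^ 6 * t0 D ^ 2 * Real.exp (-(ell D ^ 10 / 4))) := by
      positivity
    calc 24 * Real.exp 1 * ((D : ℝ) * bigP D ^ 6 * t0 D ^ 2 * Real.exp (-(ell D ^ 10 / 4)))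
          * |(-alpha D) - (-s.re - 1 / 2)|
        ≤ 24 * Real.exp 1 * ((D : ℝ) * bigP D ^ 6 * t0 D ^ 2 * Real.exp (-(ell D ^ 10 / 4))) * 2 :=
          mul_le_mul_of_nonneg_left hlen h0
      _ = 48 * Real.exp 1 * ((D : ℝ) * bigP D ^ 6 * t0 D ^ 2 * Real.exp (-(ell D ^ 10 / 4))) := by ring
      _ ≤ 48 * Real.exp 1 * epsW (1 / 24) D := mul_le_mul_of_nonneg_left key (by positivity)
  have hH1 : ‖∫ u in (-s.re - 1 / 2)..(-alpha D), perronIntegrand D (f48 χ x s)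
      ((u : ℂ) - ((ell D ^ 20 : ℝ) : ℂ) * I)‖ ≤ 48 * Real.exp 1 * epsW (1 / 24) D := by
    have h := hHor (-ell D ^ 20) (by rw [abs_neg, abs_of_nonneg (by linarith)])
    have e : ∀ u : ℝ, (u : ℂ) + ((-ell D ^ 20 : ℝ) : ℂ) * I = (u : ℂ) - ((ell D ^ 20 : ℝ) : ℂ) * I := by
      intro u; push_cast; ring
    simp_rw [e] at h
    exact h
  have hH2 : ‖∫ u in (-s.re - 1 / 2)..(-alpha D), perronIntegrand D (f48 χ x s)
      ((u : ℂ) + ((ell D ^ 20 : ℝ) : ℂ) * I)‖ ≤ 48 * Real.exp 1 * epsW (1 / 24) D :=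
    hHor (ell D ^ 20) (abs_of_nonneg (by linarith))
  ----------------------------------------------------------------
  -- (T) tails
  ----------------------------------------------------------------
  have hTail_fin : (4 * Real.exp 1 * ((D : ℝ) * bigP D ^ 6) *
      ((2 * (2 + 9 * t0 D) ^ 2 + 24 * ell D ^ 30) * Real.exp (-(ell D ^ 20) ^ 2 / (12 * ell D ^ 30))))
        * Real.sqrt (12 * π * ell D ^ 30) ≤ 896 * Real.exp 1 * Real.sqrt (12 * π) * epsW (1 / 24) D := by
    have h := arith_tail48 hL
    rw [← hDexp, ← hPdef] at h
    have hsq : Real.sqrt (12 * π * ell D ^ 30) = Real.sqrt (12 * π) * Real.sqrt (ell D ^ 30) :=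
      Real.sqrt_mul (by positivity) _
    have hT : t0 D = ell D ^ 519 := rfl
    have hex : -(ell D ^ 20) ^ 2 / (12 * ell D ^ 30) = -(ell D ^ 10 / 12) := by
      rw [div_eq_iff (by positivity)]; ring
    rw [hεdef, hsq, hT, hex]
    calc 4 * Real.exp 1 * ((D : ℝ) * bigP D ^ 6) *
          ((2 * (2 + 9 * ell D ^ 519) ^ 2 + 24 * ell D ^ 30) * Real.exp (-(ell D ^ 10 / 12))) *
          (Real.sqrt (12 * π) * Real.sqrt (ell D ^ 30))
        = 4 * Real.exp 1 * Real.sqrt (12 * π) * ((D : ℝ) * bigP D ^ 6 *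
            (2 * (2 + 9 * ell D ^ 519) ^ 2 + 24 * ell D ^ 30) * Real.sqrt (ell D ^ 30) *
            Real.exp (-(ell D ^ 10 / 12))) := by ring
      _ ≤ 4 * Real.exp 1 * Real.sqrt (12 * π) * Real.exp (-(1 / 24) * ell D ^ 10) :=
          mul_le_mul_of_nonneg_left h (by positivity)
      _ ≤ 896 * Real.exp 1 * Real.sqrt (12 * π) * Real.exp (-(1 / 24) * ell D ^ 10) := by
          have : 0 ≤ Real.exp 1 * Real.sqrt (12 * π) * Real.exp (-(1 / 24) * ell D ^ 10) := by positivity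
          nlinarith
  have hI1 := tail48_int χ x hL100 hθ hp2 hs (S := Set.Iic (-ell D ^ 20)) measurableSet_Iic
    (fun v hv => by
      have hv' : v ≤ -ell D ^ 20 := hv
      rw [abs_of_nonpos (by linarith)]; linarith)
  have hI3 := tail48_int χ x hL100 hθ hp2 hs (S := Set.Ioi (ell D ^ 20)) measurableSet_Ioi
    (fun v hv => by
      have hv' : ell D ^ 20 < v := hv
      rw [abs_of_pos (by linarith)]; exact hv'.le)
  ----------------------------------------------------------------
  -- assembly: the line integral is the contour integral (Shift48)
  ----------------------------------------------------------------
  rw [hshift D χ hD₁ hq hp x s hs, perronContour]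
  set E := epsW (1 / 24) D with hEdef
  calc ‖(1 / (2 * π) : ℂ) *
          ((∫ v in Set.Iic (-ell D ^ 20), perronIntegrand D (f48 χ x s) (((-s.re - 1 / 2 : ℝ) : ℂ) + v * I))
            + (∫ v in (-ell D ^ 20)..(ell D ^ 20), perronIntegrand D (f48 χ x s) (((-alpha D : ℝ) : ℂ) + v * I))
            + ∫ v in Set.Ioi (ell D ^ 20), perronIntegrand D (f48 χ x s) (((-s.re - 1 / 2 : ℝ) : ℂ) + v * I))
        + (1 / (2 * π * I) : ℂ) *
          ((∫ u in (-s.re - 1 / 2)..(-alpha D), perronIntegrand D (f48 χ x s) ((u : ℂ) - ((ell D ^ 20 : ℝ) : ℂ) * I))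
            - ∫ u in (-s.re - 1 / 2)..(-alpha D), perronIntegrand D (f48 χ x s) ((u : ℂ) + ((ell D ^ 20 : ℝ) : ℂ) * I))‖
      ≤ ‖(1 / (2 * π) : ℂ)‖ *
          (‖∫ v in Set.Iic (-ell D ^ 20), perronIntegrand D (f48 χ x s) (((-s.re - 1 / 2 : ℝ) : ℂ) + v * I)‖
            + ‖∫ v in (-ell D ^ 20)..(ell D ^ 20), perronIntegrand D (f48 χ x s) (((-alpha D : ℝ) : ℂ) + v * I)‖
            + ‖∫ v in Set.Ioi (ell D ^ 20), perronIntegrand D (f48 χ x s) (((-s.re - 1 / 2 : ℝ) : ℂ) + v * I)‖)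
        + ‖(1 / (2 * π * I) : ℂ)‖ *
          (‖∫ u in (-s.re - 1 / 2)..(-alpha D), perronIntegrand D (f48 χ x s) ((u : ℂ) - ((ell D ^ 20 : ℝ) : ℂ) * I)‖
            + ‖∫ u in (-s.re - 1 / 2)..(-alpha D), perronIntegrand D (f48 χ x s) ((u : ℂ) + ((ell D ^ 20 : ℝ) : ℂ) * I)‖) := by
        refine (norm_add_le _ _).trans (add_le_add ?_ ?_)
        · rw [norm_mul]
          exact mul_le_mul_of_nonneg_left (norm_add₃_le) (norm_nonneg _)
        · rw [norm_mul]
          exact mul_le_mul_of_nonneg_left (norm_sub_le _ _) (norm_nonneg _)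
    _ ≤ 1 * (896 * Real.exp 1 * Real.sqrt (12 * π) * E
            + 2 * Real.exp 1 ^ 2 * Real.exp (2 * π) * X
            + 896 * Real.exp 1 * Real.sqrt (12 * π) * E)
        + 1 * (48 * Real.exp 1 * E + 48 * Real.exp 1 * E) := by
        refine add_le_add ?_ ?_
        · exact mul_le_mul norm_one_div_two_pi_le
            (add_le_add (add_le_add (hI1.trans hTail_fin) hMid) (hI3.trans hTail_fin))
            (by positivity) zero_le_one
        · exact mul_le_mul norm_one_div_two_pi_I_le (add_le_add hH1 hH2) (by positivity) zero_le_one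
    _ ≤ (2 * Real.exp 1 ^ 2 * Real.exp (2 * π) + 1792 * Real.exp 1 * Real.sqrt (12 * π)
          + 96 * Real.exp 1) * (X + E) := by
        have h1 : 0 ≤ 2 * Real.exp 1 ^ 2 * Real.exp (2 * π) := by positivity
        have h2 : 0 ≤ 1792 * Real.exp 1 * Real.sqrt (12 * π) := by positivity
        have h3 : 0 ≤ 96 * Real.exp 1 := by positivity
        nlinarith [mul_nonneg h1 hε0, mul_nonneg h2 hX0, mul_nonneg h3 hX0]

/-- **`Z22:§4.u034` deduction node DISCHARGED**: `Ded48a : Shift48 → Eq45 → Line48Bound` (the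
hypothesis (4.5) is not needed in its printed form: the `t`-uniform Stirling estimate is used).
[cite: Zhang2022LandauSiegel, §4 (4.8) (proof) p. 20] -/
theorem ded48a_holds : Ded48a := fun h _ => line48Bound_of_shift48 h

end Literature.NumberTheory.LFunctions.Zhang2022.Section4
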